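import Mathlib
import Summits.MatrixMultiplication.MatrixMultiplication.Theorems.AutomaticSTPPDesignsNontrivialAllScalesFamily
import Literature.Combinatorics.Additive.TripleProductProperty
import Literature.Computability.AlgebraicComplexity.GroupTheoreticMatMul
import Literature.Computability.AlgebraicComplexity.GroupTheoreticMatMulThmBProofs
import Literature.Computability.AlgebraicComplexity.PrattTrapezoidValSTPP

/-!
# Cyclic STPP designs beating their host at every exponent `τ ≥ 0.95` (calibration of the normal form)

Route `MatrixMultiplication/AutomaticSTPPDesigns`, crux `stmt-MatrixMultiplication-7356`
(`AutomaticPackingThesis`), line `Sketch`; support file. The crux is equivalent to its finite cyclic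
normal form `∀ τ > 2/3, ∃ N ≥ 2, ∃ (Aᵢ,Bᵢ,Cᵢ)` STPP in `ℤ/N` with `N < ∑ᵢ (|Aᵢ||Bᵢ||Cᵢ|)^τ`
(stub `stub_normalForm`), and its refutation is a uniform packing ceiling at some `τ₀ > 2/3`.
This file records, as a tree theorem, the first non-trivial rung of that form from the explicit
side: the normal form HOLDS for every `τ ≥ 0.95`, so any uniform ceiling must sit at `τ₀ < 0.95`.

* `exists_rotationPair_zmod` — the CKSU 2005 §5 two-triple design, hosted in a CYCLIC group: for
  pairwise coprime `n₁, n₂, n₃` the pair `(A₀,B₀,C₀) = ((H₁∖0)e₁, (H₂∖0)e₂, (H₃∖0)e₃)`,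
  `(A₁,B₁,C₁) = (B₀,C₀,A₀)` in `ℤ/n₁ × ℤ/n₂ × ℤ/n₃` (tree:
  `NontrivialAllScalesFamily.addSimultaneousTPP_coordDesign`) is carried to `ℤ/(n₁n₂n₃)` along the
  Chinese remainder isomorphism (a sum-reflecting map), with block sizes
  `(n₁-1, n₂-1, n₃-1)` and `(n₂-1, n₃-1, n₁-1)`.
* `cyclicBeat_of_ge` — with `(n₁,n₂,n₃) = (19,20,21)`: an STPP pair in `ℤ/7980` of masses
  `18·19·20 = 6840` twice, and `2·6840^τ > 7980` for every `τ ≥ 19/20` (`6840^19 > 3990^20`), i.e.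
  the normal form of the crux at every `τ ≥ 0.95` (`p = 7980`, `K = 1`). The exact threshold of this
  design is `τ* = log 3990 / log 6840 ≈ 0.939`, the best in print for cyclic hosts (route file,
  "CRT re-hosting of CKSU Prop 5.2").
* `not_uniformGap_of_ge` — consequently no `τ₀ ≥ 0.95` is a uniform packing ceiling for cyclic STPP
  designs (the refutation normal form of the crux can only hold below `0.95`).

## References

* H. Cohn, R. Kleinberg, B. Szegedy, C. Umans, *Group-theoretic algorithms for matrix
  multiplication*, FOCS 2005, arXiv:math/0511460, §5 (two-triple example), Lemma 5.4, Thm. 5.5.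
-/

-- single-conjunct summit: the mandated namespace repeats `MatrixMultiplication`.
set_option linter.dupNamespace false

noncomputable section

namespace Summit.MatrixMultiplication.MatrixMultiplication.Theorems

namespace AutomaticPackingThesis

open Finset Literature.Combinatorics.Additive Literature.Computability.AlgebraicComplexity
  NontrivialAllScalesFamily

/-- **The CKSU two-triple design in a cyclic group.** For pairwise coprime moduli there is an STPP
pair in `ℤ/(n₁n₂n₃)` with block sizes `(n₁-1, n₂-1, n₃-1)` and `(n₂-1, n₃-1, n₁-1)`: the coordinate
design of `ℤ/n₁ × ℤ/n₂ × ℤ/n₃` transported along the Chinese remainder isomorphism.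
[cite: CohnKleinbergSzegedyUmans2005, §5] -/
theorem exists_rotationPair_zmod (n₁ n₂ n₃ : ℕ) [NeZero n₁] [NeZero n₂] [NeZero n₃]
    (h₁ : Nat.Coprime n₁ (n₂ * n₃)) (h₂ : Nat.Coprime n₂ n₃) :
    ∃ (A B C : Fin 2 → Finset (ZMod (n₁ * (n₂ * n₃)))), IsSTPP A B C ∧
      (A 0).card = n₁ - 1 ∧ (B 0).card = n₂ - 1 ∧ (C 0).card = n₃ - 1 ∧
      (A 1).card = n₂ - 1 ∧ (B 1).card = n₃ - 1 ∧ (C 1).card = n₁ - 1 := by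
  classical
  -- the Chinese remainder isomorphism as a sum-reflecting map
  let e : ZMod (n₁ * (n₂ * n₃)) ≃+ ZMod n₁ × (ZMod n₂ × ZMod n₃) :=
    (ZMod.chineseRemainder h₁).toAddEquiv.trans
      (AddEquiv.prodCongr (AddEquiv.refl (ZMod n₁)) (ZMod.chineseRemainder h₂).toAddEquiv)
  set φ : ZMod n₁ × (ZMod n₂ × ZMod n₃) → ZMod (n₁ * (n₂ * n₃)) := fun x => e.symm x with hφdef
  have hφ : ∀ a b c a' b' c', φ a + φ b + φ c = φ a' + φ b' + φ c' → a + b + c = a' + b' + c' :=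
    fun a b c a' b' c' h => by simpa [hφdef] using congrArg e h
  have hφinj : Function.Injective φ := e.symm.injective
  have design := addSimultaneousTPP_coordDesign (H₁ := ZMod n₁) (H₂ := ZMod n₂) (H₃ := ZMod n₃)
  have himg := addSimultaneousTPP_image_of_reflect design φ hφ
  refine ⟨fun i => (![(univ.erase 0).image fun x : ZMod n₁ => (x, (0 : ZMod n₂), (0 : ZMod n₃)),
        (univ.erase 0).image fun y : ZMod n₂ => ((0 : ZMod n₁), y, (0 : ZMod n₃))] i).image φ,
      fun i => (![(univ.erase 0).image fun y : ZMod n₂ => ((0 : ZMod n₁), y, (0 : ZMod n₃)),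
        (univ.erase 0).image fun z : ZMod n₃ => ((0 : ZMod n₁), (0 : ZMod n₂), z)] i).image φ,
      fun i => (![(univ.erase 0).image fun z : ZMod n₃ => ((0 : ZMod n₁), (0 : ZMod n₂), z),
        (univ.erase 0).image fun x : ZMod n₁ => (x, (0 : ZMod n₂), (0 : ZMod n₃))] i).image φ,
      (isSTPP_iff_addSimultaneousTPP _ _ _).2 himg, ?_⟩
  have i1 : Function.Injective fun x : ZMod n₁ => (x, (0 : ZMod n₂), (0 : ZMod n₃)) :=
    fun a b h => by simpa using h
  have i2 : Function.Injective fun y : ZMod n₂ => ((0 : ZMod n₁), y, (0 : ZMod n₃)) :=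
    fun a b h => by simpa using h
  have i3 : Function.Injective fun z : ZMod n₃ => ((0 : ZMod n₁), (0 : ZMod n₂), z) :=
    fun a b h => by simpa using h
  simp [card_image_of_injective _ hφinj, card_image_of_injective _ i1,
    card_image_of_injective _ i2, card_image_of_injective _ i3, card_erase_of_mem (mem_univ _),
    ZMod.card]

/-- `6840^(19/20) > 3990`, i.e. `6840^19 > 3990^20`. [folklore] -/
theorem rpow_bound_6840 : (3990 : ℝ) < (6840 : ℝ) ^ ((19 : ℝ) / 20) := by
  have h20 : (0 : ℝ) < 1 / 20 := by norm_num
  have hnat : (3990 : ℝ) ^ (20 : ℕ) < (6840 : ℝ) ^ (19 : ℕ) := by norm_num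
  have h1 : (3990 : ℝ) = ((3990 : ℝ) ^ (20 : ℕ)) ^ ((1 : ℝ) / 20) := by
    rw [← Real.rpow_natCast, ← Real.rpow_mul (by norm_num)]
    norm_num
  have h2 : (6840 : ℝ) ^ ((19 : ℝ) / 20) = ((6840 : ℝ) ^ (19 : ℕ)) ^ ((1 : ℝ) / 20) := by
    rw [← Real.rpow_natCast, ← Real.rpow_mul (by norm_num)]
    norm_num
  rw [h1, h2]
  exact Real.rpow_lt_rpow (by positivity) hnat h20

/-- **A cyclic design beating its host at every exponent `τ ≥ 0.95`** (any-modulus form): the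
cyclic group `ℤ/7980` hosts an STPP pair (the CKSU two-triple design over the coprime moduli
`19, 20, 21`) of masses `18·19·20 = 6840` twice, and `2·6840^τ ≥ 2·6840^{19/20} > 7980` (exact
threshold of this design: `τ* = log 3990 / log 6840 ≈ 0.939`).
[cite: CohnKleinbergSzegedyUmans2005, §5] -/
theorem cyclicBeat_anyModulus_of_ge (τ : ℝ) (hτ : (19 : ℝ) / 20 ≤ τ) :
    ∃ (N n : ℕ) (_ : 2 ≤ N) (A B C : Fin n → Finset (ZMod N)),
      IsSTPP A B C ∧ (N : ℝ) < ∑ i, (((A i).card * (B i).card * (C i).card : ℕ) : ℝ) ^ τ := by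
  haveI : NeZero (19 : ℕ) := ⟨by norm_num⟩
  haveI : NeZero (20 : ℕ) := ⟨by norm_num⟩
  haveI : NeZero (21 : ℕ) := ⟨by norm_num⟩
  obtain ⟨A, B, C, hS, hA0, hB0, hC0, hA1, hB1, hC1⟩ :=
    exists_rotationPair_zmod 19 20 21 (by norm_num) (by norm_num)
  refine ⟨19 * (20 * 21), 2, by norm_num, A, B, C, hS, ?_⟩
  rw [Fin.sum_univ_two, hA0, hB0, hC0, hA1, hB1, hC1]
  push_cast
  have hone : (1 : ℝ) ≤ 6840 := by norm_num
  have hmono : (6840 : ℝ) ^ ((19 : ℝ) / 20) ≤ (6840 : ℝ) ^ τ :=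
    Real.rpow_le_rpow_of_exponent_le hone hτ
  have key := rpow_bound_6840
  linarith

/-- Transport of an STPP design along an equality of moduli (bookkeeping for `ZMod (N^1)` versus
`ZMod N`): same block sizes. [folklore] -/
theorem isSTPP_transport_eq {M M' : ℕ} (h : M = M') {n : ℕ} {A B C : Fin n → Finset (ZMod M)}
    (hS : IsSTPP A B C) :
    ∃ (A' B' C' : Fin n → Finset (ZMod M')), IsSTPP A' B' C' ∧
      ∀ i, (A' i).card = (A i).card ∧ (B' i).card = (B i).card ∧ (C' i).card = (C i).card := by
  subst h
  exact ⟨A, B, C, hS, fun i => ⟨rfl, rfl, rfl⟩⟩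

/-- **The normal form of the crux holds at every exponent `τ ≥ 0.95`**, in the exact shape of the
registered stub `stub_cyclicBeat` (`p = 7980`, `K = 1`). [cite: CohnKleinbergSzegedyUmans2005, §5] -/
theorem cyclicBeat_of_ge (τ : ℝ) (hτ : (19 : ℝ) / 20 ≤ τ) :
    ∃ (p K n : ℕ) (_ : 2 ≤ p) (A B C : Fin n → Finset (ZMod (p ^ K))),
      IsSTPP A B C ∧ (p : ℝ) ^ K < ∑ i, (((A i).card * (B i).card * (C i).card : ℕ) : ℝ) ^ τ := by
  obtain ⟨N, n, hN, A, B, C, hS, hbeat⟩ := cyclicBeat_anyModulus_of_ge τ hτ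
  obtain ⟨A', B', C', hS', hcard⟩ := isSTPP_transport_eq (pow_one N).symm hS
  refine ⟨N, 1, n, hN, A', B', C', hS', ?_⟩
  have hsum : ∑ i, (((A' i).card * (B' i).card * (C' i).card : ℕ) : ℝ) ^ τ =
      ∑ i, (((A i).card * (B i).card * (C i).card : ℕ) : ℝ) ^ τ :=
    Finset.sum_congr rfl fun i _ => by rw [(hcard i).1, (hcard i).2.1, (hcard i).2.2]
  rw [hsum]
  push_cast
  simpa using hbeat

/-- **No uniform packing ceiling at `τ₀ ≥ 0.95`.** The refutation normal form of the crux (a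
`τ₀ > 2/3` with `∑ᵢ (|Aᵢ||Bᵢ||Cᵢ|)^{τ₀} ≤ N` for every STPP design in every `ℤ/N`, `N ≥ 2`) can only
hold with `τ₀ < 19/20`. [folklore] -/
theorem not_uniformGap_of_ge (τ₀ : ℝ) (hτ₀ : (19 : ℝ) / 20 ≤ τ₀) :
    ¬ ∀ (N n : ℕ), 2 ≤ N → ∀ (A B C : Fin n → Finset (ZMod N)),
      IsSTPP A B C → ∑ i, (((A i).card * (B i).card * (C i).card : ℕ) : ℝ) ^ τ₀ ≤ (N : ℝ) := by
  intro h
  obtain ⟨N, n, hN, A, B, C, hS, hbeat⟩ := cyclicBeat_anyModulus_of_ge τ₀ hτ₀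
  exact absurd (hbeat.trans_le (h N n hN A B C hS)) (lt_irrefl _)

/-- Registered stub `stub_cyclicBeat_of_ge095` of crux stmt-MatrixMultiplication-7356 (line `Sketch`,
calibration of the load-bearing stub `stub_cyclicBeat`): its statement holds for every `τ ≥ 19/20`
— verbatim `cyclicBeat_of_ge`. [folklore] -/
theorem stub_cyclicBeat_of_ge095 : ∀ τ : ℝ, (19 : ℝ) / 20 ≤ τ →
    ∃ (p K n : ℕ) (_ : 2 ≤ p) (A B C : Fin n → Finset (ZMod (p ^ K))),
      Literature.Computability.AlgebraicComplexity.IsSTPP A B C ∧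
        (p : ℝ) ^ K < ∑ i, (((A i).card * (B i).card * (C i).card : ℕ) : ℝ) ^ τ :=
  cyclicBeat_of_ge

end AutomaticPackingThesis

end Summit.MatrixMultiplication.MatrixMultiplication.Theorems

end
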